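import Mathlib
import Summits.ValiantsHypothesis.ValiantsHypothesis.Theorems.LiouvilleSarnakAlignedTypeICharactersMod2nDefs
import HarnessLib

/-!
# Route LiouvilleSarnak — support `AlignedTypeI` (stmt-ValiantsHypothesis-21040), line `characters_mod_2n`:
# the assembly `stub_assembly : KMTVariance → TwistedLiouvilleSmall → AlignedTypeI`

Registered line `Cruxes/AlignedTypeI/Lines/characters_mod_2n.lean` (planner val-width-lines-2, 2026-08-27;
tagged «calibration-only»: its two other stubs are cite-grade).  `AlignedTypeI` (the T5b rung under the
held milestone `DigitalBilinearLiouville`, stmt-14774): for every `ε > 0` and all large `n`,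
`Σ_{a < 2^n} |Σ_{b < 2^n} λ(a + 2^n b + 1)| ≤ ε · 4^n`.  This file proves the line's third stub, the
ASSEMBLY, verbatim and by name over the companion objects file
`Theorems/LiouvilleSarnakAlignedTypeICharactersMod2nDefs.lean` (`KMTVariance`, `TwistedLiouvilleSmall`,
`KMTBSImpliesAligned` byte-identical to the line; row/class sums and dyadic fibres):

* `unit_sum_le` — one dyadic level `k` from the variance (Cauchy–Schwarz) and the twisted sums;
* `alignedTypeI_of_KMT_BS` — the implication with both hypotheses SPELLED OUT;
* `stub_assembly : KMTBSImpliesAligned` — the registered stub, signature verbatim.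

## Proof (elementary bookkeeping; simpler than the line card's sketch — no character orthogonality is needed)

Write `a + 1 = 2^(n-k) · u` with `u` odd (`k = n - v₂(a+1) ∈ [0, n]`).  By `λ(2^j x) = (-1)^j λ(x)` the
row sum `T_n(a)` is `± A_{n,k}(u)`, `A_{n,k}(u) = Σ_{b<2^n} λ(u + 2^k b)`; the fibre `k` contributes at most
`U_k := Σ_{u ∈ (ℤ/2^k)ˣ} |A_{n,k}(u)|` for `k ≥ 1` and at most `2^(n+k)` always (companion file).  For
`k₀ ≤ k ≤ n` (`unit_sum_le`): with the KMT character `χ` and main terms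
`M_u = χ(u) φ(2^k)⁻¹ Σ_{m ≤ 2^(n+k)} λ(m) χ̄(m)`, Cauchy–Schwarz over the `φ(2^k) ≤ 2^k` units turns the
variance bound `Σ_u |A_u − M_u|² ≤ δ² 2^k 4^n` into `Σ_u |A_u − M_u| ≤ δ 2^(n+k)`, while
`Σ_u |M_u| ≤ |Σ_m λ(m) χ̄(m)| ≤ ε₂ 2^(n+k)` by the twisted-sum bound (the conjugate has the same norm);
hence `U_k ≤ (δ + ε₂) 2^(n+k)`.  Summing the geometric series (`alignedTypeI_of_KMT_BS`):
`S(n) ≤ 2^n · 2^(max k₀ 1) + 2(δ + ε₂) 4^n ≤ ε 4^n` once `δ = ε₂ = ε/8` and `2^n ≥ n ≥ 2^(k₀+2)/ε`.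

HONEST FRAMING.  This closes the LINE only modulo its two cite-grade stubs `stub_kmtVariance`
(Klurman–Mangerel–Teräväinen 2023 Thm 1.3, specialised) and `stub_twistedLiouvilleSmall`
(Banks–Shparlinski 2019 Thm 2.2 + Siegel–Walfisz), which stay HYPOTHESES here (0 facts minted); the item
`AlignedTypeI` is NOT closed by this file (`alignedTypeI_of_KMT_BS` is conditional on them), the milestone
14774 and the route's cruxes are untouched, and nothing here bears on `VP ≠ VNP` (NOT proved).
No definitions, no named facts.
-/

set_option linter.dupNamespace false

noncomputable section

namespace Summit.ValiantsHypothesis.ValiantsHypothesis.Theorems.LiouvilleSarnak.AlignedTypeI.CharactersModTwoN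

open ArithmeticFunction Finset
open scoped BigOperators

/-! ## §5 One dyadic level from the variance (Cauchy–Schwarz) and the twisted sums -/

/-- **Level `k` from KMT + BS.** If the variance of the class sums of `λ` to modulus `2^k` around the
one-character main term is `≤ δ² 2^k 4^n` and the twisted sum `Σ_{m ≤ 2^(n+k)} λ(m) χ(m)` is
`≤ ε₂ 2^(n+k)` in norm, then `Σ_{u ∈ (ℤ/2^k)ˣ} |A_{n,k}(u)| ≤ (δ + ε₂) 2^(n+k)`: Cauchy–Schwarz over
the `φ(2^k) ≤ 2^k` units for the deviation, and `φ(2^k) · (1/φ(2^k)) · ‖Σ λ χ̄‖` for the main terms.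
[folklore] -/
theorem unit_sum_le {n k : ℕ} {δ ε₂ : ℝ} (hδ : 0 ≤ δ) (χ : DirichletCharacter ℂ (2 ^ k))
    (hV : ∑ u : (ZMod (2 ^ k))ˣ,
        ‖(∑ b : Fin (2 ^ n), ((ArithmeticFunction.liouville ((u : ZMod (2 ^ k)).val + 2 ^ k * (b : ℕ)) : ℤ) : ℂ))
          - χ (u : ZMod (2 ^ k)) / (Nat.totient (2 ^ k) : ℂ) *
            ∑ m : Fin (2 ^ (n + k)), ((ArithmeticFunction.liouville ((m : ℕ) + 1) : ℤ) : ℂ) *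
              star (χ (((m : ℕ) + 1 : ℕ) : ZMod (2 ^ k)))‖ ^ 2
        ≤ δ ^ 2 * 2 ^ k * 4 ^ n)
    (hL : ‖∑ m : Fin (2 ^ (n + k)), ((ArithmeticFunction.liouville ((m : ℕ) + 1) : ℤ) : ℂ) *
        χ (((m : ℕ) + 1 : ℕ) : ZMod (2 ^ k))‖ ≤ ε₂ * 2 ^ (n + k)) :
    ∑ u : (ZMod (2 ^ k))ˣ, (|classSum n k (u : ZMod (2 ^ k)).val| : ℝ) ≤ (δ + ε₂) * 2 ^ (n + k) := by
  haveI : NeZero (2 ^ k) := ⟨pow_ne_zero _ two_ne_zero⟩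
  -- names
  set L : ℂ := ∑ m : Fin (2 ^ (n + k)), ((ArithmeticFunction.liouville ((m : ℕ) + 1) : ℤ) : ℂ) *
      star (χ (((m : ℕ) + 1 : ℕ) : ZMod (2 ^ k))) with hLdef
  set A : (ZMod (2 ^ k))ˣ → ℂ := fun u =>
    ∑ b : Fin (2 ^ n), ((ArithmeticFunction.liouville ((u : ZMod (2 ^ k)).val + 2 ^ k * (b : ℕ)) : ℤ) : ℂ)
    with hAdef
  set M : (ZMod (2 ^ k))ˣ → ℂ := fun u => χ (u : ZMod (2 ^ k)) / (Nat.totient (2 ^ k) : ℂ) * L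
    with hMdef
  have hV' : ∑ u, ‖A u - M u‖ ^ 2 ≤ δ ^ 2 * 2 ^ k * 4 ^ n := hV
  -- (i) the main-term generator `L` is the conjugate of the twisted sum
  have hLconj : L = star (∑ m : Fin (2 ^ (n + k)), ((ArithmeticFunction.liouville ((m : ℕ) + 1) : ℤ) : ℂ) *
      χ (((m : ℕ) + 1 : ℕ) : ZMod (2 ^ k))) := by
    rw [hLdef, star_sum]
    refine Finset.sum_congr rfl fun m _ => ?_
    rw [star_mul', star_intCast]
  have hLnorm : ‖L‖ ≤ ε₂ * 2 ^ (n + k) := by rw [hLconj, norm_star]; exact hL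
  -- (ii) the main terms sum to at most `‖L‖`
  have hφpos : (0 : ℝ) < (Nat.totient (2 ^ k) : ℝ) := by
    exact_mod_cast Nat.totient_pos.2 (Nat.two_pow_pos k)
  have hcardφ : (Fintype.card (ZMod (2 ^ k))ˣ : ℝ) = (Nat.totient (2 ^ k) : ℝ) := by
    exact_mod_cast ZMod.card_units_eq_totient (2 ^ k)
  have hM : ∑ u, ‖M u‖ ≤ ‖L‖ := by
    have hMu : ∀ u, ‖M u‖ ≤ ‖L‖ / (Nat.totient (2 ^ k) : ℝ) := by
      intro u
      rw [hMdef]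
      simp only
      rw [norm_mul, norm_div, Complex.norm_natCast]
      have h1 : ‖χ (u : ZMod (2 ^ k))‖ ≤ 1 := χ.norm_le_one _
      calc ‖χ (u : ZMod (2 ^ k))‖ / (Nat.totient (2 ^ k) : ℝ) * ‖L‖
          ≤ 1 / (Nat.totient (2 ^ k) : ℝ) * ‖L‖ := by gcongr
        _ = ‖L‖ / (Nat.totient (2 ^ k) : ℝ) := by ring
    calc ∑ u, ‖M u‖ ≤ ∑ _u : (ZMod (2 ^ k))ˣ, ‖L‖ / (Nat.totient (2 ^ k) : ℝ) :=
          Finset.sum_le_sum fun u _ => hMu u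
      _ = (Fintype.card (ZMod (2 ^ k))ˣ : ℝ) * (‖L‖ / (Nat.totient (2 ^ k) : ℝ)) := by
          rw [Finset.sum_const, nsmul_eq_mul, Finset.card_univ]
      _ = ‖L‖ := by rw [hcardφ]; field_simp
  -- (iii) Cauchy–Schwarz on the deviations
  have hD : ∑ u, ‖A u - M u‖ ≤ δ * 2 ^ k * 2 ^ n := by
    have hsq : (∑ u, ‖A u - M u‖) ^ 2 ≤ (δ * 2 ^ k * 2 ^ n) ^ 2 := by
      calc (∑ u, ‖A u - M u‖) ^ 2
          ≤ (Finset.univ : Finset (ZMod (2 ^ k))ˣ).card * ∑ u, ‖A u - M u‖ ^ 2 :=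
            sq_sum_le_card_mul_sum_sq
        _ ≤ (2 : ℝ) ^ k * (δ ^ 2 * 2 ^ k * 4 ^ n) := by
            gcongr
            · rw [Finset.card_univ]; exact_mod_cast card_units_le k
        _ = (δ * 2 ^ k * 2 ^ n) ^ 2 := by
            have : (4 : ℝ) ^ n = (2 ^ n) ^ 2 := by
              rw [← pow_mul, mul_comm, pow_mul]; norm_num
            rw [this]; ring
    have h0 : 0 ≤ ∑ u, ‖A u - M u‖ := Finset.sum_nonneg fun _ _ => norm_nonneg _
    have h0' : 0 ≤ δ * 2 ^ k * 2 ^ n := by positivity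
    exact (pow_le_pow_iff_left₀ h0 h0' two_ne_zero).1 hsq
  -- (iv) triangle inequality
  have hA : ∑ u, ‖A u‖ ≤ (δ + ε₂) * 2 ^ (n + k) := by
    calc ∑ u, ‖A u‖ ≤ ∑ u, (‖A u - M u‖ + ‖M u‖) :=
          Finset.sum_le_sum fun u _ => by
            simpa using norm_add_le (A u - M u) (M u)
      _ = ∑ u, ‖A u - M u‖ + ∑ u, ‖M u‖ := Finset.sum_add_distrib
      _ ≤ δ * 2 ^ k * 2 ^ n + ε₂ * 2 ^ (n + k) := add_le_add hD (hM.trans hLnorm)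
      _ = (δ + ε₂) * 2 ^ (n + k) := by ring
  -- (v) `‖A u‖ = |A_{n,k}(u)|`
  have hAu : ∀ u, ‖A u‖ = (|classSum n k (u : ZMod (2 ^ k)).val| : ℝ) := by
    intro u
    rw [hAdef]
    simp only
    have : (∑ b : Fin (2 ^ n),
        ((ArithmeticFunction.liouville ((u : ZMod (2 ^ k)).val + 2 ^ k * (b : ℕ)) : ℤ) : ℂ)) =
        ((classSum n k (u : ZMod (2 ^ k)).val : ℤ) : ℂ) := by
      rw [classSum]; push_cast; rfl
    rw [this, Complex.norm_intCast]
  calc ∑ u : (ZMod (2 ^ k))ˣ, (|classSum n k (u : ZMod (2 ^ k)).val| : ℝ)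
      = ∑ u, ‖A u‖ := Finset.sum_congr rfl fun u _ => (hAu u).symm
    _ ≤ (δ + ε₂) * 2 ^ (n + k) := hA


/-! ## §6 The assembly -/

/-- Geometric bookkeeping: `Σ_{k < m} 2^k ≤ 2^m` (in `ℝ`). [folklore] -/
theorem sum_two_pow_le (m : ℕ) : ∑ k ∈ Finset.range m, (2 : ℝ) ^ k ≤ 2 ^ m := by
  have h := geom_sum_eq (x := (2 : ℝ)) (by norm_num) m
  rw [h]
  norm_num

/-- **The assembly `KMTVariance → TwistedLiouvilleSmall → AlignedTypeI`** (hypotheses spelled out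
verbatim = the line's `KMTVariance` and `TwistedLiouvilleSmall`; conclusion = the route decl
`AlignedTypeI` BY NAME).  Dyadic split `a + 1 = 2^(n-k)·u` (`u` odd): the fibre `k` contributes
`Σ_{u ∈ (ℤ/2^k)ˣ} |Σ_{b<2^n} λ(u + 2^k b)|`, which is `≤ 2^(n+k)` trivially (used for `k < k₀`) and
`≤ (δ + ε₂) 2^(n+k)` for `k₀ ≤ k ≤ n` by Cauchy–Schwarz on the KMT variance (`ε₁ = δ²`) plus the
twisted-sum bound on the one-character main terms; summing the geometric series,
`S(n) ≤ 2^(n + k₀) + 2(δ + ε₂) 4^n ≤ ε 4^n` for `δ = ε₂ = ε/8` and `2^n ≥ 2^(k₀+2)/ε`. [folklore] -/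
theorem alignedTypeI_of_KMT_BS
    (hKMT : ∀ ε : ℝ, 0 < ε → ∃ k₀ n₀ : ℕ, ∀ n ≥ n₀, ∀ k : ℕ, k₀ ≤ k → k ≤ n →
      ∃ χ : DirichletCharacter ℂ (2 ^ k),
        ∑ u : (ZMod (2 ^ k))ˣ,
          ‖(∑ b : Fin (2 ^ n), ((ArithmeticFunction.liouville ((u : ZMod (2 ^ k)).val + 2 ^ k * (b : ℕ)) : ℤ) : ℂ))
            - χ (u : ZMod (2 ^ k)) / (Nat.totient (2 ^ k) : ℂ) *
              ∑ m : Fin (2 ^ (n + k)), ((ArithmeticFunction.liouville ((m : ℕ) + 1) : ℤ) : ℂ) *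
                star (χ (((m : ℕ) + 1 : ℕ) : ZMod (2 ^ k)))‖ ^ 2
          ≤ ε * 2 ^ k * 4 ^ n)
    (hBS : ∀ ε : ℝ, 0 < ε → ∃ n₀ : ℕ, ∀ n ≥ n₀, ∀ k ≤ n, ∀ χ : DirichletCharacter ℂ (2 ^ k),
      ‖∑ m : Fin (2 ^ (n + k)), ((ArithmeticFunction.liouville ((m : ℕ) + 1) : ℤ) : ℂ) *
          χ (((m : ℕ) + 1 : ℕ) : ZMod (2 ^ k))‖ ≤ ε * 2 ^ (n + k)) :
    Summit.ValiantsHypothesis.ValiantsHypothesis.Theses.LiouvilleSarnak.AlignedTypeI := by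
  intro ε hε
  -- constants
  set δ : ℝ := ε / 8 with hδdef
  have hδ : 0 < δ := by positivity
  obtain ⟨k₀, n₁, hK⟩ := hKMT (δ ^ 2) (by positivity)
  obtain ⟨n₂, hB⟩ := hBS δ hδ
  obtain ⟨N, hN⟩ := exists_nat_ge (2 ^ (k₀ + 2) / ε)
  set k₁ : ℕ := max k₀ 1 with hk₁def
  refine ⟨max n₁ (max n₂ N), fun n hn => ?_⟩
  have hn1 : n₁ ≤ n := le_trans (le_max_left _ _) hn
  have hn2 : n₂ ≤ n := le_trans ((le_max_left _ _).trans (le_max_right _ _)) hn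
  have hnN : N ≤ n := le_trans ((le_max_right _ _).trans (le_max_right _ _)) hn
  -- the goal's row sums are the `rowSum`s
  have hgoal : (∑ a : Fin (2 ^ n), |∑ b : Fin (2 ^ n),
      ((ArithmeticFunction.liouville ((a : ℕ) + 2 ^ n * (b : ℕ) + 1) : ℤ) : ℝ)|) =
      ∑ a : Fin (2 ^ n), (|rowSum n a| : ℝ) := by
    refine Finset.sum_congr rfl fun a _ => ?_
    rw [rowSum, Int.cast_sum]
  rw [hgoal, sum_fiberwise]
  -- fibre bounds
  have hfib : ∀ k ∈ Finset.range (n + 1), ∑ a ∈ fib n k, (|rowSum n a| : ℝ) ≤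
      (2 : ℝ) ^ n * (if k < k₁ then (2 : ℝ) ^ k else 0) + 2 * δ * ((2 : ℝ) ^ n * 2 ^ k) := by
    intro k hk
    have hkn : k ≤ n := Nat.lt_succ_iff.1 (Finset.mem_range.1 hk)
    have hpos : (0 : ℝ) ≤ 2 * δ * ((2 : ℝ) ^ n * 2 ^ k) := by positivity
    by_cases hlt : k < k₁
    · rw [if_pos hlt]
      calc ∑ a ∈ fib n k, (|rowSum n a| : ℝ) ≤ 2 ^ (n + k) := fiber_sum_le_trivial hkn
        _ = (2 : ℝ) ^ n * 2 ^ k + 0 := by rw [pow_add, add_zero]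
        _ ≤ (2 : ℝ) ^ n * 2 ^ k + 2 * δ * ((2 : ℝ) ^ n * 2 ^ k) := by gcongr
    · rw [if_neg hlt, mul_zero, zero_add]
      have hk1 : 1 ≤ k := le_trans (le_max_right _ _) (not_lt.1 hlt)
      have hk0 : k₀ ≤ k := le_trans (le_max_left _ _) (not_lt.1 hlt)
      obtain ⟨χ, hχ⟩ := hK n hn1 k hk0 hkn
      have hL := hB n hn2 k hkn χ
      calc ∑ a ∈ fib n k, (|rowSum n a| : ℝ)
          ≤ ∑ u : (ZMod (2 ^ k))ˣ, (|classSum n k (u : ZMod (2 ^ k)).val| : ℝ) :=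
            fiber_sum_le_unit_sum hk1 hkn
        _ ≤ (δ + δ) * 2 ^ (n + k) := unit_sum_le hδ.le χ hχ hL
        _ = 2 * δ * ((2 : ℝ) ^ n * 2 ^ k) := by rw [pow_add]; ring
  -- summation
  have hind : ∑ k ∈ Finset.range (n + 1), (if k < k₁ then (2 : ℝ) ^ k else 0) ≤ 2 ^ k₁ := by
    rw [← Finset.sum_filter]
    calc ∑ k ∈ (Finset.range (n + 1)).filter (fun k => k < k₁), (2 : ℝ) ^ k
        ≤ ∑ k ∈ Finset.range k₁, (2 : ℝ) ^ k := by
          refine Finset.sum_le_sum_of_subset_of_nonneg ?_ fun _ _ _ => by positivity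
          intro k hk
          simp only [Finset.mem_filter, Finset.mem_range] at hk ⊢
          exact hk.2
      _ ≤ 2 ^ k₁ := sum_two_pow_le k₁
  have hgeo : ∑ k ∈ Finset.range (n + 1), ((2 : ℝ) ^ n * 2 ^ k) ≤ (2 : ℝ) ^ n * 2 ^ (n + 1) := by
    rw [← Finset.mul_sum]
    gcongr
    exact sum_two_pow_le (n + 1)
  -- the threshold: `2^n · 2^k₁ ≤ (ε/2) · 4^n`
  have h2n : (n : ℝ) ≤ (2 : ℝ) ^ n := by exact_mod_cast (Nat.lt_two_pow_self).le
  have hk₁le : k₁ ≤ k₀ + 1 := by omega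
  have hthr : (2 : ℝ) ^ n * 2 ^ k₁ ≤ ε / 2 * ((2 : ℝ) ^ n * 2 ^ n) := by
    have h1 : (2 : ℝ) ^ (k₀ + 2) / ε ≤ (2 : ℝ) ^ n := le_trans (le_trans hN (by exact_mod_cast hnN)) h2n
    have h2 : (2 : ℝ) ^ (k₀ + 2) ≤ ε * (2 : ℝ) ^ n := by
      rw [div_le_iff₀ hε] at h1; linarith
    have h3 : (2 : ℝ) ^ k₁ ≤ (2 : ℝ) ^ (k₀ + 1) := pow_le_pow_right₀ (by norm_num) hk₁le
    have h4 : (2 : ℝ) ^ (k₀ + 2) = 2 * (2 : ℝ) ^ (k₀ + 1) := by ring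
    have h5 : (0 : ℝ) ≤ (2 : ℝ) ^ n := by positivity
    nlinarith
  have h4n : (4 : ℝ) ^ n = (2 : ℝ) ^ n * 2 ^ n := by
    rw [← mul_pow]; norm_num
  calc ∑ k ∈ Finset.range (n + 1), ∑ a ∈ fib n k, (|rowSum n a| : ℝ)
      ≤ ∑ k ∈ Finset.range (n + 1),
          ((2 : ℝ) ^ n * (if k < k₁ then (2 : ℝ) ^ k else 0) + 2 * δ * ((2 : ℝ) ^ n * 2 ^ k)) :=
        Finset.sum_le_sum hfib
    _ = (2 : ℝ) ^ n * ∑ k ∈ Finset.range (n + 1), (if k < k₁ then (2 : ℝ) ^ k else 0) +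
          2 * δ * ∑ k ∈ Finset.range (n + 1), ((2 : ℝ) ^ n * 2 ^ k) := by
        rw [Finset.sum_add_distrib, Finset.mul_sum, Finset.mul_sum]
    _ ≤ (2 : ℝ) ^ n * 2 ^ k₁ + 2 * δ * ((2 : ℝ) ^ n * 2 ^ (n + 1)) := by gcongr
    _ ≤ ε / 2 * ((2 : ℝ) ^ n * 2 ^ n) + 2 * δ * ((2 : ℝ) ^ n * 2 ^ (n + 1)) := by gcongr
    _ = ε * 4 ^ n := by rw [h4n, hδdef]; ring


/-- **Registered stub `stub_assembly` of line `characters_mod_2n` (signature verbatim):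
`KMTBSImpliesAligned`, i.e. `KMTVariance → TwistedLiouvilleSmall → AlignedTypeI`.** [folklore] -/
theorem stub_assembly : KMTBSImpliesAligned := fun hKMT hBS => alignedTypeI_of_KMT_BS hKMT hBS

end Summit.ValiantsHypothesis.ValiantsHypothesis.Theorems.LiouvilleSarnak.AlignedTypeI.CharactersModTwoN

end
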